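import Summits.AtomisticToContinuum.Crystallization.Theorems.ExcessDecayLiouvilleCaccioppoliBound
import Summits.AtomisticToContinuum.Crystallization.Theorems.ExcessDecayLiouvilleCutoff

/-!
# Route `ExcessDecayLiouville`: the interior gradient estimate (first-order Caccioppoli on a ball)

Step (c2), first order, of the energy route for item `ExcessDecay` (stmt-AtomisticToContinuum-9334; item
evidence `ExcessDecay-proof-architecture-v2.md`, §5).  For a finitely supported displacement `h` on the
sites of an admissible datum, a lattice vector `τ ∈ Λ₀` with `‖Aτ‖ ≤ 11/10`, the coercivity constant
`κ ≥ 0` of `coercive_of_phononStability`, and a cutoff `η` (finitely supported inside the site set, slope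
`1/ρ` between sites) which equals `1` at the points `x` and `x + Aτ` for `x` in a finite set `F` of sites:

`κ · Σ_{x ∈ F} ‖h x − h (x + Aτ)‖² ≤ Σ'_p η_p² ⟪(L h)(p), h p⟫ + (19·C₆/ρ²) Σ'_p ‖h p‖²`

(`gradient_estimate_of_cutoff`); with the radial site cutoff of `ExcessDecayLiouvilleCutoff.lean` (`= 1` on
the sites of `dist · c ≤ r₁`) this applies to every finite set `F` of sites with `dist x c ≤ r₁ − 11/10`
(`gradient_estimate`).  This is the discrete Caccioppoli inequality in the form that gets iterated on
difference quotients: the squared discrete gradient on the inner ball is controlled by the work of the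
residual force `L h` against `η² h` plus `ρ⁻²` times the `ℓ²` mass of `h`.
All `[folklore]`; helper lemmas, nothing here closes an item.
-/

noncomputable section

namespace Summit.AtomisticToContinuum.Crystallization.Theorems.ExcessDecayLiouville

open scoped BigOperators Topology InnerProductSpace RealInnerProductSpace Classical
open Literature.MathematicalPhysics.StatisticalMechanics
open Summit.AtomisticToContinuum.Crystallization.Theorems.PhononStabilityNegative

section

variable {t : Fin 2 → (EuclideanSpace ℝ (Fin 3))} {A : (EuclideanSpace ℝ (Fin 3)) →L[ℝ] (EuclideanSpace ℝ (Fin 3))}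

/-- The squared differences along a lattice translation form a finitely supported (hence summable)
family, for finitely supported `v` (direct proof, stated without the translation self-map). [folklore] -/
theorem summable_norm_sub_translate_sq {v : (EuclideanSpace ℝ (Fin 3)) → (EuclideanSpace ℝ (Fin 3))}
    (hv : (Function.support v).Finite) {τ : (EuclideanSpace ℝ (Fin 3))} (hτ : τ ∈ Λ₀) :
    Summable (fun p : Sites₀ t A => ‖v p - v ((p : (EuclideanSpace ℝ (Fin 3))) + A τ)‖ ^ 2) := by
  classical
  set T := (finite_support_sites (t := t) (A := A) hv).toFinset with hT
  let back : Sites₀ t A → Sites₀ t A := fun q => ⟨q - A τ, sub_mem_sites₀ q.2 hτ⟩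
  refine summable_of_ne_finset_zero (s := T ∪ T.image back) ?_
  intro p hp
  rw [Finset.notMem_union] at hp
  have hvp : v p = 0 := by
    by_contra h
    exact hp.1 ((Set.Finite.mem_toFinset _).2 h)
  have hvq : v ((p : (EuclideanSpace ℝ (Fin 3))) + A τ) = 0 := by
    by_contra h
    apply hp.2
    refine Finset.mem_image.2 ⟨⟨(p : (EuclideanSpace ℝ (Fin 3))) + A τ, add_mem_sites₀ p.2 hτ⟩,
      (Set.Finite.mem_toFinset _).2 h, ?_⟩
    ext
    simp [back]
  simp [hvp, hvq]

/-- **Interior gradient estimate for an abstract cutoff** (see the module docstring). [folklore] -/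
theorem gradient_estimate_of_cutoff (hA : Adm₀ A) (hI : Inner₀ t A) {κ : ℝ} (hκ0 : 0 ≤ κ)
    (hκ : ∀ v : (EuclideanSpace ℝ (Fin 3)) → (EuclideanSpace ℝ (Fin 3)), (Function.support v).Finite → Function.support v ⊆ Sites₀ t A →
      κ * nnForm t A v ≤ ∑' p : Sites₀ t A, ⟪∑' q : Sites₀ t A,
        (if (p : (EuclideanSpace ℝ (Fin 3))) ≠ q then ((-((‖(p : (EuclideanSpace ℝ (Fin 3))) - q‖ ^ 2)⁻¹) ^ 7 + ((‖(p : (EuclideanSpace ℝ (Fin 3))) - q‖ ^ 2)⁻¹) ^ 4) • (v p - v q) + (2 * ⟪(p : (EuclideanSpace ℝ (Fin 3))) - q, v p - v q⟫ * (7 * ((‖(p : (EuclideanSpace ℝ (Fin 3))) - q‖ ^ 2)⁻¹) ^ 8 - 4 * ((‖(p : (EuclideanSpace ℝ (Fin 3))) - q‖ ^ 2)⁻¹) ^ 5)) • ((p : (EuclideanSpace ℝ (Fin 3))) - q)) else 0), v p⟫)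
    {h : (EuclideanSpace ℝ (Fin 3)) → (EuclideanSpace ℝ (Fin 3))} (hh : (Function.support h).Finite)
    {η : (EuclideanSpace ℝ (Fin 3)) → ℝ} (hη : (Function.support η).Finite) (hηS : Function.support η ⊆ Sites₀ t A)
    {ρ : ℝ} (hρ : 0 < ρ) (hlip : ∀ p q : Sites₀ t A, |η p - η q| ≤ ‖(p : (EuclideanSpace ℝ (Fin 3))) - q‖ / ρ)
    {τ : (EuclideanSpace ℝ (Fin 3))} (hτ : τ ∈ Λ₀) (hτn : ‖A τ‖ ≤ 11 / 10)
    (F : Finset (EuclideanSpace ℝ (Fin 3))) (hF : ∀ x ∈ F, x ∈ Sites₀ t A ∧ η x = 1 ∧ η (x + A τ) = 1) :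
    κ * ∑ x ∈ F, ‖h x - h (x + A τ)‖ ^ 2 ≤
      (∑' p : Sites₀ t A, (η p) ^ 2 * ⟪∑' q : Sites₀ t A, (if (p : (EuclideanSpace ℝ (Fin 3))) ≠ q then ((-((‖(p : (EuclideanSpace ℝ (Fin 3))) - q‖ ^ 2)⁻¹) ^ 7 + ((‖(p : (EuclideanSpace ℝ (Fin 3))) - q‖ ^ 2)⁻¹) ^ 4) • (h p - h q) + (2 * ⟪(p : (EuclideanSpace ℝ (Fin 3))) - q, h p - h q⟫ * (7 * ((‖(p : (EuclideanSpace ℝ (Fin 3))) - q‖ ^ 2)⁻¹) ^ 8 - 4 * ((‖(p : (EuclideanSpace ℝ (Fin 3))) - q‖ ^ 2)⁻¹) ^ 5)) • ((p : (EuclideanSpace ℝ (Fin 3))) - q)) else 0), h p⟫) +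
      19 * (1024 / ((23 / 25 : ℝ) ^ 3 * (23 / 25 : ℝ) ^ 3)) / ρ ^ 2 * ∑' p : Sites₀ t A, ‖h p‖ ^ 2 := by
  classical
  -- Caccioppoli (inhomogeneous ℓ² form) for the cut-off displacement a = η • h
  have hC := caccioppoli_l2_inhomogeneous hA hI hκ hh hη hηS hρ hlip
  have ha : (Function.support fun x : (EuclideanSpace ℝ (Fin 3)) => η x • h x).Finite :=
    hη.subset fun x hx => by
      simp only [Function.mem_support, ne_eq, smul_eq_zero, not_or] at hx ⊢
      exact hx.1
  -- nnForm(a) dominates the squared translation differences of a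
  have hD := tsum_norm_sub_translate_sq_le_nnForm hA hI ha hτ hτn
  -- the finite sum over F is a partial sum of that tsum
  have hsum : Summable (fun p : Sites₀ t A =>
      ‖η p • h p - η ((p : (EuclideanSpace ℝ (Fin 3))) + A τ) • h ((p : (EuclideanSpace ℝ (Fin 3))) + A τ)‖ ^ 2) :=
    summable_norm_sub_translate_sq (t := t) (A := A) ha hτ
  set G : Finset (Sites₀ t A) := F.attach.image (fun x => ⟨x.1, (hF x.1 x.2).1⟩) with hG
  have hinj : Set.InjOn (fun x : {x // x ∈ F} => (⟨x.1, (hF x.1 x.2).1⟩ : Sites₀ t A))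
      (F.attach : Set {x // x ∈ F}) := by
    intro a _ b _ hab
    have : (a : (EuclideanSpace ℝ (Fin 3))) = b := congrArg (fun s : Sites₀ t A => (s : (EuclideanSpace ℝ (Fin 3)))) hab
    exact Subtype.ext this
  have hpart : ∑ x ∈ F, ‖h x - h (x + A τ)‖ ^ 2 ≤
      ∑' p : Sites₀ t A, ‖η p • h p - η ((p : (EuclideanSpace ℝ (Fin 3))) + A τ) • h ((p : (EuclideanSpace ℝ (Fin 3))) + A τ)‖ ^ 2 := by
    have h1 : ∑ x ∈ F, ‖h x - h (x + A τ)‖ ^ 2 =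
        ∑ p ∈ G, ‖η p • h p - η ((p : (EuclideanSpace ℝ (Fin 3))) + A τ) • h ((p : (EuclideanSpace ℝ (Fin 3))) + A τ)‖ ^ 2 := by
      rw [hG, Finset.sum_image hinj, ← Finset.sum_attach F]
      refine Finset.sum_congr rfl fun x _ => ?_
      obtain ⟨-, hx1, hx2⟩ := hF x.1 x.2
      simp only [hx1, hx2, one_smul]
    rw [h1]
    exact hsum.sum_le_tsum G (fun p _ => sq_nonneg _)
  calc κ * ∑ x ∈ F, ‖h x - h (x + A τ)‖ ^ 2
      ≤ κ * ∑' p : Sites₀ t A, ‖η p • h p - η ((p : (EuclideanSpace ℝ (Fin 3))) + A τ) • h ((p : (EuclideanSpace ℝ (Fin 3))) + A τ)‖ ^ 2 :=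
        mul_le_mul_of_nonneg_left hpart hκ0
    _ ≤ κ * nnForm t A (fun x => η x • h x) := mul_le_mul_of_nonneg_left hD hκ0
    _ ≤ _ := hC

/-- **Interior gradient estimate** with the radial site cutoff `η = [x∈S]·max (min 1 ((r₁+ρ−dist x c)/ρ)) 0`:
for every finite set `F` of sites with `dist x c ≤ r₁ − 11/10`,
`κ · Σ_{x ∈ F} ‖h x − h (x + Aτ)‖² ≤ Σ'_p η_p² ⟪(L h)(p), h p⟫ + (19·C₆/ρ²) Σ'_p ‖h p‖²`. [folklore] -/
theorem gradient_estimate (hA : Adm₀ A) (hI : Inner₀ t A) {κ : ℝ} (hκ0 : 0 ≤ κ)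
    (hκ : ∀ v : (EuclideanSpace ℝ (Fin 3)) → (EuclideanSpace ℝ (Fin 3)), (Function.support v).Finite → Function.support v ⊆ Sites₀ t A →
      κ * nnForm t A v ≤ ∑' p : Sites₀ t A, ⟪∑' q : Sites₀ t A,
        (if (p : (EuclideanSpace ℝ (Fin 3))) ≠ q then ((-((‖(p : (EuclideanSpace ℝ (Fin 3))) - q‖ ^ 2)⁻¹) ^ 7 + ((‖(p : (EuclideanSpace ℝ (Fin 3))) - q‖ ^ 2)⁻¹) ^ 4) • (v p - v q) + (2 * ⟪(p : (EuclideanSpace ℝ (Fin 3))) - q, v p - v q⟫ * (7 * ((‖(p : (EuclideanSpace ℝ (Fin 3))) - q‖ ^ 2)⁻¹) ^ 8 - 4 * ((‖(p : (EuclideanSpace ℝ (Fin 3))) - q‖ ^ 2)⁻¹) ^ 5)) • ((p : (EuclideanSpace ℝ (Fin 3))) - q)) else 0), v p⟫)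
    {h : (EuclideanSpace ℝ (Fin 3)) → (EuclideanSpace ℝ (Fin 3))} (hh : (Function.support h).Finite)
    (c : (EuclideanSpace ℝ (Fin 3))) (r₁ : ℝ) {ρ : ℝ} (hρ : 0 < ρ) {τ : (EuclideanSpace ℝ (Fin 3))} (hτ : τ ∈ Λ₀) (hτn : ‖A τ‖ ≤ 11 / 10)
    (F : Finset (EuclideanSpace ℝ (Fin 3))) (hF : ∀ x ∈ F, x ∈ Sites₀ t A ∧ dist x c ≤ r₁ - 11 / 10) :
    κ * ∑ x ∈ F, ‖h x - h (x + A τ)‖ ^ 2 ≤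
      (∑' p : Sites₀ t A, ((if (p : (EuclideanSpace ℝ (Fin 3))) ∈ Sites₀ t A then max (min 1 ((r₁ + ρ - dist (p : (EuclideanSpace ℝ (Fin 3))) c) / ρ)) 0 else 0)) ^ 2 *
          ⟪∑' q : Sites₀ t A, (if (p : (EuclideanSpace ℝ (Fin 3))) ≠ q then ((-((‖(p : (EuclideanSpace ℝ (Fin 3))) - q‖ ^ 2)⁻¹) ^ 7 + ((‖(p : (EuclideanSpace ℝ (Fin 3))) - q‖ ^ 2)⁻¹) ^ 4) • (h p - h q) + (2 * ⟪(p : (EuclideanSpace ℝ (Fin 3))) - q, h p - h q⟫ * (7 * ((‖(p : (EuclideanSpace ℝ (Fin 3))) - q‖ ^ 2)⁻¹) ^ 8 - 4 * ((‖(p : (EuclideanSpace ℝ (Fin 3))) - q‖ ^ 2)⁻¹) ^ 5)) • ((p : (EuclideanSpace ℝ (Fin 3))) - q)) else 0), h p⟫) +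
      19 * (1024 / ((23 / 25 : ℝ) ^ 3 * (23 / 25 : ℝ) ^ 3)) / ρ ^ 2 * ∑' p : Sites₀ t A, ‖h p‖ ^ 2 := by
  refine gradient_estimate_of_cutoff hA hI hκ0 hκ hh
    (η := fun x : (EuclideanSpace ℝ (Fin 3)) => (if x ∈ Sites₀ t A then max (min 1 ((r₁ + ρ - dist x c) / ρ)) 0 else 0))
    (siteCutoff_support_finite hA hI c r₁ hρ) (siteCutoff_support_subset c r₁ ρ) hρ
    (fun p q => abs_siteCutoff_sub_le hρ p q) hτ hτn F fun x hx => ?_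
  obtain ⟨hxS, hxc⟩ := hF x hx
  have hx2S : x + A τ ∈ Sites₀ t A := add_mem_sites₀ hxS hτ
  have hx2c : dist (x + A τ) c ≤ r₁ := by
    have := dist_triangle (x + A τ) x c
    have h2 : dist (x + A τ) x = ‖A τ‖ := by rw [dist_eq_norm, add_sub_cancel_left]
    linarith
  exact ⟨hxS, siteCutoff_eq_one hρ hxS (by linarith), siteCutoff_eq_one hρ hx2S hx2c⟩

end

end Summit.AtomisticToContinuum.Crystallization.Theorems.ExcessDecayLiouville

end
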